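import Mathlib
import HarnessLib

/-!
# Bochner-from-`lintegral` bookkeeping for the `stub_end_gaussCore` assembly (step (α) of w3 g67's SPEC 2026-08-31 22:57Z = LEAD memo11)
# (free-hands support of ⟨stmt-QuantumFields-24197⟩ `SwapVirialDeficit.SwapGluedStiffness`)

The registered stub is a BOCHNER set integral `∫_{G♭} e^{−bF̂} dμ_B ≤ …`, while the slab machinery (✓`endGauss_slab_le_of_N2`) bounds the `lintegral` of
`g = 𝟙_{G♭}·ofReal(e^{−bF̂})` over the hub slab `{|δ| < s} ⊇ G♭`.  This file is the one-line bridge, for any measure space: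
* ★ `setIntegral_le_of_lintegral_indicator_le` — `A ⊆ S` measurable, `f ≥ 0`, `∫⁻_S 𝟙_A·ofReal f ≤ ofReal C` (`C ≥ 0`) ⟹ `∫_A f ≤ C`;
* `lintegral_indicator_restrict_eq` — `∫⁻_S 𝟙_A·F = ∫⁻_A F` for `A ⊆ S`; `measurable_indicator_ofReal_exp` (the `g` is measurable), `indicator_ofReal_exp_le`.

HONEST LABEL: Mathlib bookkeeping; `stub_end_gaussCore` (N2 w2, shell g48, final assembly) and `stub_core_tip`, ⟨24197⟩ ∕ ⟨24194⟩ and every rung OPEN; own crux ⟨22884⟩ OPEN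
(blocked-on ⟨19935⟩); the Yang–Mills mass gap is NOT proved; no summit is proved by a line.  THEOREMS ONLY (0 `def`, 0 `sorry`), standard axioms.
Width seat ym-line-sfw-p2-w3 g67 (cell ym-idea-1, free hands), `--supports stmt-QuantumFields-24197`.  References: [folklore].
-/

set_option autoImplicit false

noncomputable section

open MeasureTheory Set
open scoped ENNReal

namespace Summit.QuantumFields.YangMills.Theorems.SwapVirialDeficit.SigmaBall

variable {X : Type*} [MeasurableSpace X] {μ : Measure X}

/-- `∫⁻_S 𝟙_A·F = ∫⁻_A F` for measurable `A ⊆ S`. [folklore] -/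
theorem lintegral_indicator_restrict_eq {A S : Set X} (hA : MeasurableSet A) (hAS : A ⊆ S) (F : X → ℝ≥0∞) :
    ∫⁻ x in S, A.indicator F x ∂μ = ∫⁻ x in A, F x ∂μ := by
  rw [lintegral_indicator hA, Measure.restrict_restrict hA, inter_eq_left.2 hAS]

/-- ★ **BOCHNER FROM `lintegral`**: for measurable `A ⊆ S`, `f ≥ 0` on `A`, `0 ≤ C` and `∫⁻_S 𝟙_A·ofReal f ≤ ofReal C`, the Bochner set integral obeys `∫_A f ≤ C`
(if `f` is not integrable on `A` the Bochner integral is `0 ≤ C`). [folklore] -/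
theorem setIntegral_le_of_lintegral_indicator_le {A S : Set X} (hA : MeasurableSet A) (hAS : A ⊆ S) {f : X → ℝ} (hf0 : ∀ x ∈ A, 0 ≤ f x) {C : ℝ} (hC : 0 ≤ C)
    (h : ∫⁻ x in S, A.indicator (fun x => ENNReal.ofReal (f x)) x ∂μ ≤ ENNReal.ofReal C) :
    ∫ x in A, f x ∂μ ≤ C := by
  rw [lintegral_indicator_restrict_eq hA hAS] at h
  by_cases hint : Integrable f (μ.restrict A)
  · rw [integral_eq_lintegral_of_nonneg_ae ((ae_restrict_mem hA).mono fun x hx => hf0 x hx) hint.aestronglyMeasurable]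
    exact ENNReal.toReal_le_of_le_ofReal hC h
  · rw [integral_undef hint]; exact hC

/-- The slab integrand `𝟙_A·ofReal(exp(−b·F))` is measurable for measurable `A`, `F`. [folklore] -/
theorem measurable_indicator_ofReal_exp {A : Set X} (hA : MeasurableSet A) {F : X → ℝ} (hF : Measurable F) (b : ℝ) :
    Measurable fun x => A.indicator (fun x => ENNReal.ofReal (Real.exp (-(b * F x)))) x :=
  (Measurable.ennreal_ofReal (by fun_prop)).indicator hA

omit [MeasurableSpace X] in
/-- Pointwise: `𝟙_A·ofReal(exp(−b·F)) ≤ ofReal(exp(−b·F))` — the fact the `hF`-provider uses off/on `A`. [folklore] -/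
theorem indicator_ofReal_exp_le {A : Set X} {F : X → ℝ} (b : ℝ) (x : X) :
    A.indicator (fun x => ENNReal.ofReal (Real.exp (-(b * F x)))) x ≤ ENNReal.ofReal (Real.exp (-(b * F x))) :=
  Set.indicator_le_self _ _ x

end Summit.QuantumFields.YangMills.Theorems.SwapVirialDeficit.SigmaBall

end
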